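import Summits.CriticalPhenomena.PercolationContinuityZ3.Theorems.SahiLatticeFieldMeasures
import Literature.MathematicalPhysics.QuantumLattice.LatticeScalarFieldProofs

/-!
# The lattice `φ⁴` field with `g > 0`: FKG and Sahi positivity (hypothesis-free normalisation)

Support file of the Sahi cell (`prim-sahi`, typer seat, generation 13; `--supports stmt-CriticalPhenomena-4575`).
Theorems only (no definitions, no named facts, no sorries).  Companion of `SahiLatticeFieldMeasures.lean`, whose
`φ⁴` theorems carry the normalisation as an instance hypothesis `[IsProbabilityMeasure (phi4Measure G g κ J)]`; the
tree proves it for `g > 0` (`isProbabilityMeasure_phi4Measure_holds`, `LatticeScalarFieldProofs`), so here the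
statements are closed: for EVERY finite graph `G`, `g > 0`, `κ ∈ ℝ` and ferromagnetic `J ≥ 0`,

* `phi4_integral_mul_integral_le` — **the FKG inequality for the lattice `φ⁴` field**
  `dμ = Z⁻¹ e^{−∑_x (g φ_x⁴ + κ φ_x²) + J ∑_{xy} φ_x φ_y} ∏ dφ_x`: `∫ f ∫ g ≤ ∫ f g` for bounded measurable nonnegative
  increasing `f, g` (and for decreasing pairs, `phi4_integral_mul_integral_le_antitone`);
* `phi4_msahiE_nonneg` (+ `_antitone`, `_of_sahiConjecture`) — **given `LiebSahiContinuum |V| n` (⟸ `C_n`), the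
  `φ⁴` field is Sahi-positive of order `n`** for bounded measurable nonnegative monotone families.

No sorries, no new axioms.
-/

noncomputable section

namespace Summit.CriticalPhenomena.PercolationContinuityZ3.Theorems.SahiBoxTP2

open MeasureTheory ProbabilityTheory Set Filter Topology Function Literature.Combinatorics.Sahi2008
open Literature.Probability.LatticeModels Literature.MathematicalPhysics.QuantumLattice
open scoped ENNReal

variable {V : Type*} [Fintype V] (G : SimpleGraph V) [DecidableRel G.Adj] {n : ℕ}

/-- **FKG FOR THE LATTICE `φ⁴` FIELD** (`g > 0`, any `κ`, ferromagnetic `J ≥ 0`, any finite graph): for bounded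
measurable nonnegative increasing `f₁, f₂ : ℝ^V → ℝ`, `∫ f₁ ∫ f₂ ≤ ∫ f₁ f₂` under `phi4Measure G g κ J`. [this work] -/
theorem phi4_integral_mul_integral_le {g : ℝ} (hg : 0 < g) (κ : ℝ) {J : ℝ} (hJ : 0 ≤ J) {f₁ f₂ : (V → ℝ) → ℝ}
    (h1m : Measurable f₁) (h2m : Measurable f₂) (h10 : ∀ x, 0 ≤ f₁ x) (h20 : ∀ x, 0 ≤ f₂ x) {M : ℝ}
    (h1M : ∀ x, f₁ x ≤ M) (h2M : ∀ x, f₂ x ≤ M) (h1 : Monotone f₁) (h2 : Monotone f₂) :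
    (∫ x, f₁ x ∂phi4Measure G g κ J) * (∫ x, f₂ x ∂phi4Measure G g κ J) ≤
      ∫ x, f₁ x * f₂ x ∂phi4Measure G g κ J := by
  haveI := isProbabilityMeasure_phi4Measure_holds G hg κ J
  exact phi4Measure_integral_mul_integral_le G g κ hJ h1m h2m h10 h20 h1M h2M h1 h2

/-- FKG for a pair of bounded measurable nonnegative DECREASING functionals of the `φ⁴` field. [this work] -/
theorem phi4_integral_mul_integral_le_antitone {g : ℝ} (hg : 0 < g) (κ : ℝ) {J : ℝ} (hJ : 0 ≤ J)
    {f₁ f₂ : (V → ℝ) → ℝ} (h1m : Measurable f₁) (h2m : Measurable f₂) (h10 : ∀ x, 0 ≤ f₁ x) (h20 : ∀ x, 0 ≤ f₂ x)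
    {M : ℝ} (h1M : ∀ x, f₁ x ≤ M) (h2M : ∀ x, f₂ x ≤ M) (h1 : Antitone f₁) (h2 : Antitone f₂) :
    (∫ x, f₁ x ∂phi4Measure G g κ J) * (∫ x, f₂ x ∂phi4Measure G g κ J) ≤
      ∫ x, f₁ x * f₂ x ∂phi4Measure G g κ J := by
  haveI := isProbabilityMeasure_phi4Measure_holds G hg κ J
  have h := msahiE_nonneg_of_isBoxTP2_realFun_antitone (liebSahiContinuum_of_order_le_two _ le_rfl) _
    (isBoxTP2_phi4Measure G g κ hJ) ![f₁, f₂] (fun i => by fin_cases i <;> assumption)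
    (fun i => by fin_cases i <;> assumption) (M := M) (fun i => by fin_cases i <;> assumption)
    (fun i => by fin_cases i <;> assumption)
  rw [msahiE_two] at h
  linarith

/-- **Given `L(|V|, n)`: the lattice `φ⁴` field (`g > 0`, `J ≥ 0`) is Sahi-positive of order `n`** for bounded
measurable nonnegative increasing families. [this work] -/
theorem phi4_msahiE_nonneg (hL : LiebSahiContinuum (Fintype.card V) n) {g : ℝ} (hg : 0 < g) (κ : ℝ) {J : ℝ}
    (hJ : 0 ≤ J) (f : Fin n → (V → ℝ) → ℝ) (hfm : ∀ i, Measurable (f i)) (hf0 : ∀ i x, 0 ≤ f i x) {M : ℝ}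
    (hfM : ∀ i x, f i x ≤ M) (hmono : ∀ i, Monotone (f i)) : 0 ≤ msahiE (phi4Measure G g κ J) n f := by
  haveI := isProbabilityMeasure_phi4Measure_holds G hg κ J
  exact phi4Measure_msahiE_nonneg G hL g κ hJ f hfm hf0 hfM hmono

/-- Decreasing families. [this work] -/
theorem phi4_msahiE_nonneg_antitone (hL : LiebSahiContinuum (Fintype.card V) n) {g : ℝ} (hg : 0 < g) (κ : ℝ)
    {J : ℝ} (hJ : 0 ≤ J) (f : Fin n → (V → ℝ) → ℝ) (hfm : ∀ i, Measurable (f i)) (hf0 : ∀ i x, 0 ≤ f i x)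
    {M : ℝ} (hfM : ∀ i x, f i x ≤ M) (hanti : ∀ i, Antitone (f i)) : 0 ≤ msahiE (phi4Measure G g κ J) n f := by
  haveI := isProbabilityMeasure_phi4Measure_holds G hg κ J
  exact msahiE_nonneg_of_isBoxTP2_realFun_antitone hL _ (isBoxTP2_phi4Measure G g κ hJ) f hfm hf0 hfM hanti

/-- From `C_n`. [this work; cite: Sahi2008, Conj. 5 (p. 212); LiebSahi2021, Conj. 1.1] -/
theorem phi4_msahiE_nonneg_of_sahiConjecture (hC : SahiConjecture n) {g : ℝ} (hg : 0 < g) (κ : ℝ) {J : ℝ}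
    (hJ : 0 ≤ J) (f : Fin n → (V → ℝ) → ℝ) (hfm : ∀ i, Measurable (f i)) (hf0 : ∀ i x, 0 ≤ f i x) {M : ℝ}
    (hfM : ∀ i x, f i x ≤ M) (hmono : ∀ i, Monotone (f i)) : 0 ≤ msahiE (phi4Measure G g κ J) n f :=
  phi4_msahiE_nonneg G ((sahiConjecture_iff_forall_liebSahiContinuum n).1 hC _) hg κ hJ f hfm hf0 hfM hmono

end Summit.CriticalPhenomena.PercolationContinuityZ3.Theorems.SahiBoxTP2
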